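import Literature.Probability.RandomPlanarGeometry.HexSAWBrickWallStripFugacityWidthOneContactSusceptibilityUniform
import Literature.Probability.RandomPlanarGeometry.HexSAWBrickWallStripFugacityWidthOneContactImbalance
import HarnessLib

/-!
# The imbalance and total-contact susceptibilities; closed forms for the uniform strip

Child module of `…ContactSusceptibilityUniform` (entropy Hessian at the uniform typical pair: `m₁₁ = m₂₂ = 28μ²+10μ−2`, `m₁₂ = 24μ²+8μ+4`) and
`…ContactImbalance` (the imbalance susceptibility `(m₁₁ + 2m₁₂ + m₂₂)/D` along anti-rays).
* §1 ★★ the TOTAL contact density `b + b'` along rays `(e^{A+s}, e^{B+s})` has derivative `(m₁₁ − 2m₁₂ + m₂₂)/D > 0` (susceptibility to a common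
  field; the qualitative monotonicity is the tree's `totalDensity_ray_strictMono`);
* §2 ★★★ **UNIFORM STRIP**: the imbalance susceptibility is `1/(2μ² + μ − 3) ∈ (0.5449, 0.5452)` and the total-contact susceptibility is
  `1/(26μ² + 9μ + 1) ∈ (0.01707, 0.01709)` (`μ = μ(S₁)` the plastic number) — a uniform strip walk responds 32 times more strongly to an
  ANTISYMMETRIC wall field than to a symmetric one.

## Sources
DemboZeitouni2010 §2.2 (lane statement); BeatonBousquetMelouDeGierDuminilCopinGuttmann2014 §3.2 Proposition 6 (arXiv v5 p. 10).  Nothing quoted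
AS PRINTED; closed forms are this lineage's (`ℚ(μ)`, `μ³ = μ+1`).
-/

noncomputable section

open Filter Topology Finset Literature.Probability.LatticeModels Literature.Probability.Percolation SimpleGraph

namespace Literature.Probability.RandomPlanarGeometry.SAW.HexBW

open WidthOneYZ Real

/-! ## §1 The total contact density along rays -/

/-- ★★ **SUSCEPTIBILITY TO A COMMON FIELD**: for all `A, B`, `s ↦ b(e^{A+s},e^{B+s}) + b(e^{B+s},e^{A+s})` has derivative
`(m₁₁ − 2m₁₂ + m₂₂)/D > 0` at `s = 0` (`M⁻¹` applied to `(1,1)` and summed; positivity: `m₁₁ + m₂₂ − 2m₁₂ = 2/P + 2/Q − 1/b − 1/b' > 0` is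
not needed — `M⁻¹` is positive definite). [cite: DemboZeitouni2010, §2.2 (lane statement)] -/
theorem hasDerivAt_totalDensity_ray (A B : ℝ) :
    let b := contactB (Real.exp A) (Real.exp B)
    let b' := contactB (Real.exp B) (Real.exp A)
    let m₁₁ := 4 / (1 - 2 * b - 2 * b') + 8 / (4 * b + 2 * b' - 1) + 2 / (2 * b + 4 * b' - 1) - 1 / b
    let m₁₂ := 4 / (1 - 2 * b - 2 * b') + 4 / (4 * b + 2 * b' - 1) + 4 / (2 * b + 4 * b' - 1)
    let m₂₂ := 4 / (1 - 2 * b - 2 * b') + 2 / (4 * b + 2 * b' - 1) + 8 / (2 * b + 4 * b' - 1) - 1 / b'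
    HasDerivAt (fun s : ℝ => contactB (Real.exp (A + s)) (Real.exp (B + s)) + contactB (Real.exp (B + s)) (Real.exp (A + s)))
      ((m₁₁ - 2 * m₁₂ + m₂₂) / (m₁₁ * m₂₂ - m₁₂ ^ 2)) 0 ∧
    0 < (m₁₁ - 2 * m₁₂ + m₂₂) / (m₁₁ * m₂₂ - m₁₂ ^ 2) := by
  intro b b' m₁₁ m₁₂ m₂₂
  obtain ⟨E, hE, hg⟩ := hasStrictFDerivAt_densityMap A B
  obtain ⟨hD, -, -, -, -, -, -⟩ := hasDerivAt_contactB_log A B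
  set D := m₁₁ * m₂₂ - m₁₂ ^ 2 with hDdef
  have hD0 : D ≠ 0 := ne_of_gt hD
  have hinv : E.symm (1, 1) = ((m₂₂ - m₁₂) / D, (m₁₁ - m₁₂) / D) := by
    have h := hE ((m₂₂ - m₁₂) / D, (m₁₁ - m₁₂) / D)
    have e : E ((m₂₂ - m₁₂) / D, (m₁₁ - m₁₂) / D) = (1, 1) := by
      rw [h]
      refine Prod.ext ?_ ?_
      · show m₁₁ * ((m₂₂ - m₁₂) / D) + m₁₂ * ((m₁₁ - m₁₂) / D) = 1
        field_simp; rw [hDdef]; ring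
      · show m₁₂ * ((m₂₂ - m₁₂) / D) + m₂₂ * ((m₁₁ - m₁₂) / D) = 1
        field_simp; rw [hDdef]; ring
    rw [← e, ContinuousLinearEquiv.symm_apply_apply]
  have hline : HasDerivAt (fun s : ℝ => ((A + s, B + s) : ℝ × ℝ)) ((1, 1) : ℝ × ℝ) 0 := by
    have h1 : HasDerivAt (fun s : ℝ => A + s) 1 0 := by simpa using (hasDerivAt_id (0 : ℝ)).const_add A
    have h2 : HasDerivAt (fun s : ℝ => B + s) 1 0 := by simpa using (hasDerivAt_id (0 : ℝ)).const_add B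
    exact h1.prodMk h2
  have hg0 : HasFDerivAt (fun q : ℝ × ℝ => ((contactB (Real.exp q.1) (Real.exp q.2), contactB (Real.exp q.2) (Real.exp q.1)) : ℝ × ℝ))
      (E.symm : (ℝ × ℝ) →L[ℝ] (ℝ × ℝ)) ((A + 0, B + 0) : ℝ × ℝ) := by
    simp only [add_zero]; exact hg.hasFDerivAt
  have hcomp := hg0.comp_hasDerivAt (0 : ℝ) hline
  rw [ContinuousLinearEquiv.coe_coe, hinv] at hcomp
  have d1 := (hasFDerivAt_fst (𝕜 := ℝ) (E := ℝ) (F := ℝ)).comp_hasDerivAt 0 hcomp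
  have d2 := (hasFDerivAt_snd (𝕜 := ℝ) (E := ℝ) (F := ℝ)).comp_hasDerivAt 0 hcomp
  have d := d1.add d2
  simp only [Function.comp_def] at d
  have hval : (m₂₂ - m₁₂) / D + (m₁₁ - m₁₂) / D = (m₁₁ - 2 * m₁₂ + m₂₂) / D := by field_simp; ring
  refine ⟨?_, ?_⟩
  · rw [← hval]; exact d
  · rw [← hval]
    -- `(1,1)·M⁻¹(1,1) > 0` by the free-energy Hessian positivity pattern: `m₁₁ H D = (m₁₁ − m₁₂)² + D`
    obtain ⟨t1, t2, t3⟩ := contactB_mem_triangle (Real.exp_pos A) (Real.exp_pos B)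
    obtain ⟨hm11, -⟩ := logTiltDeriv_det_pos t1 t2 t3
    have key : m₁₁ * (m₂₂ - m₁₂ + (m₁₁ - m₁₂)) = (m₁₁ - m₁₂) ^ 2 + (m₁₁ * m₂₂ - m₁₂ ^ 2) := by ring
    have hpos : 0 < m₂₂ - m₁₂ + (m₁₁ - m₁₂) := by
      have : 0 < (m₁₁ - m₁₂) ^ 2 + (m₁₁ * m₂₂ - m₁₂ ^ 2) := by nlinarith [sq_nonneg (m₁₁ - m₁₂)]
      nlinarith [key]
    have : (m₂₂ - m₁₂) / D + (m₁₁ - m₁₂) / D = (m₂₂ - m₁₂ + (m₁₁ - m₁₂)) / D := by field_simp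
    rw [this]
    exact div_pos hpos hD

/-! ## §2 The uniform strip: imbalance and total susceptibilities in closed form -/

/-- ★★★ **THE IMBALANCE SUSCEPTIBILITY OF THE UNIFORM STRIP**: `d/ds [b(e^s, e^{−s}) − b(e^{−s}, e^s)]|₀ = 1/(2μ² + μ − 3)`, `μ = μ(S₁)`.
[cite: DemboZeitouni2010, §2.2 (lane statement); BeatonBousquetMelouDeGierDuminilCopinGuttmann2014, §3.2 Proposition 6 (arXiv v5 p. 10)] -/
theorem imbalanceSusceptibility_uniform :
    HasDerivAt (fun s : ℝ => contactB (Real.exp s) (Real.exp (-s)) - contactB (Real.exp (-s)) (Real.exp s))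
      (1 / (2 * stripConnectiveConstant 1 ^ 2 + stripConnectiveConstant 1 - 3)) 0 := by
  set μ := stripConnectiveConstant 1 with hμ
  have h := (hasDerivAt_imbalance_antiRay 0 0).1
  simp only [Real.exp_zero, zero_add, zero_sub] at h
  obtain ⟨e11, e12, eD, hDpos⟩ := entropyHessian_uniform
  rw [← hμ] at e11 e12 eD hDpos
  have e22 : 4 / (1 - 2 * contactB 1 1 - 2 * contactB 1 1) + 2 / (4 * contactB 1 1 + 2 * contactB 1 1 - 1) +
      8 / (2 * contactB 1 1 + 4 * contactB 1 1 - 1) - 1 / contactB 1 1 = 28 * μ ^ 2 + 10 * μ - 2 := by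
    rw [← e11]; ring
  rw [e11, e12, e22] at h
  have hμ1 : (1.3247 : ℝ) < μ := by rw [hμ]; exact stripConnectiveConstant_one_mem_Ioo.1
  have hne : (28 * μ ^ 2 + 10 * μ - 2) - (24 * μ ^ 2 + 8 * μ + 4) ≠ 0 := by nlinarith
  have hden : (28 * μ ^ 2 + 10 * μ - 2) * (28 * μ ^ 2 + 10 * μ - 2) - (24 * μ ^ 2 + 8 * μ + 4) ^ 2 ≠ 0 := by
    rw [eD]; exact hDpos.ne'
  refine h.congr_deriv ?_
  have h23 : (2 : ℝ) * μ ^ 2 + μ - 3 ≠ 0 := by nlinarith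
  rw [div_eq_div_iff hden h23]
  ring

/-- ★★★ **THE TOTAL-CONTACT SUSCEPTIBILITY OF THE UNIFORM STRIP**: `d/ds [b(e^s, e^s) + b(e^s, e^s)]|₀ = 1/(26μ² + 9μ + 1)` — about `1/32`
of the imbalance susceptibility. [cite: DemboZeitouni2010, §2.2 (lane statement); BeatonBousquetMelouDeGierDuminilCopinGuttmann2014, §3.2 Proposition 6 (arXiv v5 p. 10)] -/
theorem totalSusceptibility_uniform :
    HasDerivAt (fun s : ℝ => contactB (Real.exp s) (Real.exp s) + contactB (Real.exp s) (Real.exp s))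
      (1 / (26 * stripConnectiveConstant 1 ^ 2 + 9 * stripConnectiveConstant 1 + 1)) 0 := by
  set μ := stripConnectiveConstant 1 with hμ
  have h := (hasDerivAt_totalDensity_ray 0 0).1
  simp only [Real.exp_zero, zero_add] at h
  obtain ⟨e11, e12, eD, hDpos⟩ := entropyHessian_uniform
  rw [← hμ] at e11 e12 eD hDpos
  have e22 : 4 / (1 - 2 * contactB 1 1 - 2 * contactB 1 1) + 2 / (4 * contactB 1 1 + 2 * contactB 1 1 - 1) +
      8 / (2 * contactB 1 1 + 4 * contactB 1 1 - 1) - 1 / contactB 1 1 = 28 * μ ^ 2 + 10 * μ - 2 := by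
    rw [← e11]; ring
  rw [e11, e12, e22] at h
  have hμ1 : (1.3247 : ℝ) < μ := by rw [hμ]; exact stripConnectiveConstant_one_mem_Ioo.1
  have hden : (28 * μ ^ 2 + 10 * μ - 2) * (28 * μ ^ 2 + 10 * μ - 2) - (24 * μ ^ 2 + 8 * μ + 4) ^ 2 ≠ 0 := by
    rw [eD]; exact hDpos.ne'
  refine h.congr_deriv ?_
  have h23 : (26 : ℝ) * μ ^ 2 + 9 * μ + 1 ≠ 0 := by nlinarith
  rw [div_eq_div_iff hden h23]
  ring

/-- ★★ **Numerically**: `0.5449 < 1/(2μ²+μ−3) < 0.5452` and `0.01707 < 1/(26μ²+9μ+1) < 0.01709` (from `1.3247 < μ < 1.3248`).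
[cite: DemboZeitouni2010, §2.2 (lane statement)] -/
theorem susceptibilities_uniform_bounds :
    (0.5449 : ℝ) < 1 / (2 * stripConnectiveConstant 1 ^ 2 + stripConnectiveConstant 1 - 3) ∧
      1 / (2 * stripConnectiveConstant 1 ^ 2 + stripConnectiveConstant 1 - 3) < 0.5452 ∧
      (0.01707 : ℝ) < 1 / (26 * stripConnectiveConstant 1 ^ 2 + 9 * stripConnectiveConstant 1 + 1) ∧
      1 / (26 * stripConnectiveConstant 1 ^ 2 + 9 * stripConnectiveConstant 1 + 1) < 0.01709 := by
  have hμ1 : (1.3247 : ℝ) < stripConnectiveConstant 1 := stripConnectiveConstant_one_mem_Ioo.1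
  have hμ2 : stripConnectiveConstant 1 < (1.3248 : ℝ) := stripConnectiveConstant_one_mem_Ioo.2
  have hp1 : 0 < 2 * stripConnectiveConstant 1 ^ 2 + stripConnectiveConstant 1 - 3 := by nlinarith
  have hp2 : 0 < 26 * stripConnectiveConstant 1 ^ 2 + 9 * stripConnectiveConstant 1 + 1 := by nlinarith
  refine ⟨?_, ?_, ?_, ?_⟩
  · rw [lt_div_iff₀ hp1]; nlinarith
  · rw [div_lt_iff₀ hp1]; nlinarith
  · rw [lt_div_iff₀ hp2]; nlinarith
  · rw [div_lt_iff₀ hp2]; nlinarith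

end Literature.Probability.RandomPlanarGeometry.SAW.HexBW
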